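import Summits.ValiantsHypothesis.ValiantsHypothesis.Theses.SOSTau
import Literature.Computability.AlgebraicComplexity.TavenasVnWitness
import Literature.Computability.AlgebraicComplexity.ValiantCriterion
import Literature.Computability.AlgebraicComplexity.ValiantClasses
import Literature.Computability.AlgebraicComplexity.SetMultilinear
import Literature.Computability.AlgebraicComplexity.SOSDecompositionProofs
import Summits.ValiantsHypothesis.ValiantsHypothesis.Theorems.FeketeSOSSOSMagnificationStubVnpAssembly
import Summits.ValiantsHypothesis.ValiantsHypothesis.Theorems.FeketeSOSSOSMagnificationStubDigitKronecker
import Summits.ValiantsHypothesis.ValiantsHypothesis.Theorems.FeketeSOSSOSMagnificationStubPolarisedSOS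
import Summits.ValiantsHypothesis.ValiantsHypothesis.Theorems.FeketeSOSSOSMagnificationStubBudget

/-!
# Crux `SOSTau.HutchinsonMagnification` (stmt-ValiantsHypothesis-18749) — COMPLETE CANDIDATE PROOF

planner-cruxidea-stmt-ValiantsHypothesis-18749-2-0 (crux-ideate round 1, ideator 2), 2026-08-17.
Evidence file (planners cannot write `Theorems/`); a prover may land it verbatim as
`Summits/ValiantsHypothesis/ValiantsHypothesis/Theorems/SOSTauHutchinsonMagnification.lean --workitem stmt-ValiantsHypothesis-18749`
(it also proves support items 18750 `ComplexToRealSOS` and 18751 `CollapseCheapComplexSOS` by name).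

Contents:
* Part A (idea `definability-projection`): the hex digit lift of `V_{4m}` is a `VNP` family over `ℂ` — Bürgisser Def. 2.5 with the
  TRANSCRIPT witness over Tavenas' LANDED circuit `TavenasVn.vCirc (4m)` for the bits of `vExp (4m) i` (`vnpHexLift`), and T2
  `kroneckerHex` (generic digit-lift lemmas). Stub V1 (bilinear hex exponent) of the registered line turns out to be UNNECESSARY.
* Part B: T3 `hexBudget` (quasi-poly·8^m < η·16^m) and R `complexToRealSOS` (Dutta 2021 Lemma 10, three real squares per complex square).
* Part C: the composition `collapse_of` / `HutchinsonMagnification_of` of the registered line `Lines/hex_bilinear_transport.lean`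
  (planner-cstrat-stmt-ValiantsHypothesis-18749-b1-0, PROVED there modulo stubs) with the stubs discharged — copied verbatim, since
  `Cruxes/…` modules are not built on the farm.
-/

set_option linter.dupNamespace false

noncomputable section

open Finset
open Literature.Computability.AlgebraicComplexity
open Literature.Computability.Complexity (CktSize B2 Circuit)
open CircuitArith BoolGadgets DefVNP TavenasVn
open Summit.ValiantsHypothesis.ValiantsHypothesis.Theorems.FeketeSOSSOSMagnification
  (isVNPFamily_of_levelwise' dk_isSetMultilinear_lift dk_totalDegree_lift dk_aeval_lift dk_sum_digit_mul_pow
   mul_sq_le_two_pow stub_polarisedSOS dk_partA)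

namespace Summit.ValiantsHypothesis.ValiantsHypothesis.Cruxes.HutchinsonMagnification.DefinabilityProjection

/-! # Part A — the V-half (idea `definability-projection`) -/

section PartA

open MvPolynomial


/-- Genuine variables: one-hot hex digit variables. -/
abbrev V (m : ℕ) : Type := Fin m × Fin 16

/-- Boolean block: the `4m` exponent bits ⊕ the transcript of Tavenas' circuit `vCirc (4m)`. -/
abbrev B (m : ℕ) : Type := TavenasVn.BB (4 * m)

/-- The hex digit `j` of a bit vector. -/
def hexDigit (m : ℕ) (e : Fin (4 * m) → Bool) (j : Fin m) : Fin 16 :=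
  ⟨Nat.ofBits (fun r : Fin 4 => e ⟨4 * (j : ℕ) + (r : ℕ), by omega⟩),
    (Nat.ofBits_lt_two_pow _).trans_eq (by norm_num)⟩

/-- Digit/bit dictionary: `ofBits e / 16^j % 16 = hexDigit e j`. -/
theorem ofBits_div_pow_mod (m : ℕ) (e : Fin (4 * m) → Bool) (j : Fin m) :
    Nat.ofBits e / 16 ^ (j : ℕ) % 16 = (hexDigit m e j : ℕ) := by
  apply Nat.eq_of_testBit_eq
  intro i
  have h16 : (16 : ℕ) ^ (j : ℕ) = 2 ^ (4 * (j : ℕ)) := by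
    rw [pow_mul]; norm_num
  have hmod : Nat.ofBits e / 2 ^ (4 * (j : ℕ)) % 16 = Nat.ofBits e / 2 ^ (4 * (j : ℕ)) % 2 ^ 4 := by
    norm_num
  rw [h16, hmod, Nat.testBit_mod_two_pow, Nat.testBit_div_two_pow]
  unfold hexDigit
  by_cases hi : i < 4
  · rw [decide_eq_true hi, Bool.true_and, Nat.testBit_ofBits_lt _ _ hi]
    have hlt : i + 4 * (j : ℕ) < 4 * m := by omega
    rw [Nat.testBit_ofBits_lt _ _ hlt]
    congr 1
    exact Fin.ext (by simp; omega)
  · rw [decide_eq_false hi, Bool.false_and, Nat.testBit_ofBits_ge _ _ (by omega)]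

/-- The bits of `hexDigit e j` are the block bits. -/
theorem testBit_hexDigit (m : ℕ) (e : Fin (4 * m) → Bool) (j : Fin m) (r : Fin 4) :
    Nat.testBit (hexDigit m e j : ℕ) (r : ℕ) = e ⟨4 * (j : ℕ) + (r : ℕ), by omega⟩ := by
  unfold hexDigit
  simp only
  rw [Nat.testBit_ofBits_lt _ _ r.isLt]

/-- A hex digit is determined by its four bits. -/
theorem eq_hexDigit_iff (m : ℕ) (e : Fin (4 * m) → Bool) (j : Fin m) (h : Fin 16) :
    (∀ r : Fin 4, Nat.testBit (h : ℕ) (r : ℕ) = e ⟨4 * (j : ℕ) + (r : ℕ), by omega⟩) ↔ h = hexDigit m e j := by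
  constructor
  · intro H
    apply Fin.ext
    apply Nat.eq_of_testBit_eq
    intro i
    by_cases hi : i < 4
    · rw [H ⟨i, hi⟩, testBit_hexDigit m e j ⟨i, hi⟩]
    · have h1 : (h : ℕ) < 2 ^ i := lt_of_lt_of_le h.isLt (by
        calc (16 : ℕ) = 2 ^ 4 := by norm_num
          _ ≤ 2 ^ i := Nat.pow_le_pow_right (by norm_num) (by omega))
      have h2 : (hexDigit m e j : ℕ) < 2 ^ i := lt_of_lt_of_le (hexDigit m e j).isLt (by
        calc (16 : ℕ) = 2 ^ 4 := by norm_num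
          _ ≤ 2 ^ i := Nat.pow_le_pow_right (by norm_num) (by omega))
      rw [Nat.testBit_lt_two_pow h1, Nat.testBit_lt_two_pow h2]
  · rintro rfl r
    exact testBit_hexDigit m e j r

/-! ### The witness -/

/-- Hex selector factor of block `j`: `Σ_h X_{(j,h)} · Π_{r<4} lit (bit_r h) (e_{4j+r})`. -/
def hselFactor (m : ℕ) (j : Fin m) : MvPolynomial (V m ⊕ B m) ℂ :=
  ∑ h : Fin 16, X (Sum.inl (j, h)) *
    ∏ r : Fin 4, lit (Nat.testBit (h : ℕ) (r : ℕ))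
      (X (Sum.inr (Sum.inl (⟨4 * (j : ℕ) + (r : ℕ), by omega⟩ : Fin (4 * m)))))

/-- The hex selector `HSEL = Π_j hselFactor j`. -/
def hsel (m : ℕ) : MvPolynomial (V m ⊕ B m) ℂ := ∏ j : Fin m, hselFactor m j

/-- The factor of output bit `l`: `1 + (2^{2^l} − 1)·w_l`. -/
def zFactor (m : ℕ) (l : Fin (TavenasVn.R (4 * m))) : MvPolynomial (V m ⊕ B m) ℂ :=
  1 + (C ((2 : ℂ) ^ 2 ^ (l : ℕ)) - 1) *
    rename Sum.inr (wirePoly (k := ℂ) (vCirc (4 * m)).size (vOut (4 * m) l))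

/-- The coefficient-magnitude selector `Π_l zFactor l` (z-block already projected to `2^{2^l}`). -/
def zprod (m : ℕ) : MvPolynomial (V m ⊕ B m) ℂ := ∏ l : Fin (TavenasVn.R (4 * m)), zFactor m l

/-- **The transcript witness** `W_m = VALID(vCirc (4m)) · HSEL · ZPROD`. -/
def witness (m : ℕ) : MvPolynomial (V m ⊕ B m) ℂ :=
  rename Sum.inr (validPoly (k := ℂ) (vCirc (4 * m))) * hsel m * zprod m

/-! ### Evaluation at Boolean points of the block -/

theorem toK_comp_sumElim (m : ℕ) (b : Fin (4 * m) → Bool) (y : Fin (vCirc (4 * m)).size → Bool) :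
    (toK ℂ ∘ Sum.elim b y) = bpt ℂ b y := by
  funext v; cases v <;> rfl

theorem aeval_φb_X_inl {m : ℕ} (e : B m → Bool) (v : V m) :
    aeval (φb (k := ℂ) (σ := V m) e) (X (Sum.inl v) : MvPolynomial (V m ⊕ B m) ℂ) = X v := by
  simp [φb]

/-- A literal at a Boolean point is an equality indicator. -/
theorem aeval_φb_lit {m : ℕ} (e : B m → Bool) (a : Bool) (w : B m) :
    aeval (φb (k := ℂ) (σ := V m) e) (lit a (X (Sum.inr w) : MvPolynomial (V m ⊕ B m) ℂ)) =
      if a = e w then 1 else 0 := by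
  cases a <;> cases hw : e w <;> simp [CircuitArith.lit, φb, toK, hw, map_sub]

/-- The hex selector factor at a Boolean point picks the variable of the encoded digit. -/
theorem aeval_φb_hselFactor (m : ℕ) (e : B m → Bool) (j : Fin m) :
    aeval (φb (k := ℂ) (σ := V m) e) (hselFactor m j) = X (j, hexDigit m (fun t => e (Sum.inl t)) j) := by
  classical
  unfold hselFactor
  rw [map_sum]
  have hterm : ∀ h : Fin 16, aeval (φb (k := ℂ) (σ := V m) e) ((X (Sum.inl (j, h)) : MvPolynomial (V m ⊕ B m) ℂ) *
      ∏ r : Fin 4, lit (Nat.testBit (h : ℕ) (r : ℕ))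
        (X (Sum.inr (Sum.inl (⟨4 * (j : ℕ) + (r : ℕ), by omega⟩ : Fin (4 * m)))))) =
      if h = hexDigit m (fun t => e (Sum.inl t)) j then X (j, h) else 0 := by
    intro h
    rw [map_mul, map_prod, aeval_φb_X_inl]
    simp only [aeval_φb_lit]
    rw [Fintype.prod_boole]
    by_cases hh : h = hexDigit m (fun t => e (Sum.inl t)) j
    · rw [if_pos hh, if_pos ((eq_hexDigit_iff m (fun t => e (Sum.inl t)) j h).2 hh), mul_one]
    · rw [if_neg hh, if_neg (fun H => hh ((eq_hexDigit_iff m (fun t => e (Sum.inl t)) j h).1 H)), mul_zero]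
  simp only [hterm]
  rw [Finset.sum_ite_eq' Finset.univ (hexDigit m (fun t => e (Sum.inl t)) j) (fun h => (X (j, h) : MvPolynomial (V m) ℂ))]
  simp

/-- The hex selector at a Boolean point is the one-hot monomial of the encoded digits. -/
theorem aeval_φb_hsel (m : ℕ) (e : B m → Bool) :
    aeval (φb (k := ℂ) (σ := V m) e) (hsel m) = ∏ j : Fin m, X (j, hexDigit m (fun t => e (Sum.inl t)) j) := by
  unfold hsel
  rw [map_prod]
  exact Finset.prod_congr rfl fun j _ => aeval_φb_hselFactor m e j

/-- The output-bit factor at a Boolean point `(b, y)`: `2^{2^l}` if the wire is on, else `1`. -/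
theorem aeval_φb_zFactor (m : ℕ) (b : Fin (4 * m) → Bool) (y : Fin (vCirc (4 * m)).size → Bool)
    (l : Fin (TavenasVn.R (4 * m))) :
    aeval (φb (k := ℂ) (σ := V m) (Sum.elim b y)) (zFactor m l) =
      if bwval b y (vOut (4 * m) l) then C ((2 : ℂ) ^ 2 ^ (l : ℕ)) else 1 := by
  unfold zFactor
  rw [map_add, map_one, map_mul, map_sub, map_one, MvPolynomial.aeval_C, MvPolynomial.algebraMap_eq,
    aeval_φb_rename_inr, toK_comp_sumElim, eval_wirePoly]
  cases bwval b y (vOut (4 * m) l) <;> simp [toK]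

/-- The magnitude selector at a Boolean point. -/
theorem aeval_φb_zprod (m : ℕ) (b : Fin (4 * m) → Bool) (y : Fin (vCirc (4 * m)).size → Bool) :
    aeval (φb (k := ℂ) (σ := V m) (Sum.elim b y)) (zprod m) =
      ∏ l : Fin (TavenasVn.R (4 * m)), (if bwval b y (vOut (4 * m) l) then C ((2 : ℂ) ^ 2 ^ (l : ℕ)) else 1) := by
  unfold zprod
  rw [map_prod]
  exact Finset.prod_congr rfl fun l _ => aeval_φb_zFactor m b y l

/-- A product of bit-selected powers `2^{2^l}` is `2^{ofBits}`. -/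
theorem prod_ite_pow (m : ℕ) {R : ℕ} (c : Fin R → Bool) :
    (∏ l : Fin R, (if c l then C ((2 : ℂ) ^ 2 ^ (l : ℕ)) else 1 : MvPolynomial (V m) ℂ)) =
      C ((2 : ℂ) ^ Nat.ofBits c) := by
  have h : ∀ l : Fin R, (if c l then C ((2 : ℂ) ^ 2 ^ (l : ℕ)) else 1 : MvPolynomial (V m) ℂ) =
      C ((2 : ℂ) ^ ((c l).toNat * 2 ^ (l : ℕ))) := by
    intro l; cases c l <;> simp
  simp only [h]
  rw [← map_prod, Finset.prod_pow_eq_pow_sum, ← ofBits_eq_sum]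

/-- **The witness at a Boolean point** `(b, y)`: `VALID(b,y) · Π_j X_{(j, digit_j b)} · Π_l (wire_l ? 2^{2^l} : 1)`. -/
theorem aeval_φb_witness (m : ℕ) (b : Fin (4 * m) → Bool) (y : Fin (vCirc (4 * m)).size → Bool) :
    aeval (φb (k := ℂ) (σ := V m) (Sum.elim b y)) (witness m) =
      C (MvPolynomial.eval (bpt ℂ b y) (validPoly (vCirc (4 * m)))) *
        ((∏ j : Fin m, X (j, hexDigit m b j)) *
          ∏ l : Fin (TavenasVn.R (4 * m)), (if bwval b y (vOut (4 * m) l) then C ((2 : ℂ) ^ 2 ^ (l : ℕ)) else 1)) := by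
  unfold witness
  rw [map_mul, map_mul, aeval_φb_rename_inr, toK_comp_sumElim, aeval_φb_hsel, aeval_φb_zprod, mul_assoc]
  rfl

/-- **The Boolean sum of the transcript witness, in bits** (transcript collapse). -/
theorem bsum_witness_bits (m : ℕ) :
    bsum (witness m) = ∑ b : Fin (4 * m) → Bool,
      C ((2 : ℂ) ^ vExp (4 * m) (Nat.ofBits b)) * ∏ j : Fin m, (X (j, hexDigit m b j) : MvPolynomial (V m) ℂ) := by
  unfold bsum
  rw [sum_BB]
  refine Finset.sum_congr rfl fun b _ => ?_
  simp only [aeval_φb_witness]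
  rw [sum_C_eval_validPoly_mul (vCirc (4 * m)) (isOver_vCirc (4 * m)) b]
  simp only [bwval_trueTranscript_vOut]
  rw [prod_ite_pow, mul_comm]
  congr 2
  rw [vExpBits, Literature.Computability.Complexity.ArithCkt.ofBits_bitsOf,
    Nat.mod_eq_of_lt (vExp_lt_two_pow_R (4 * m) b)]

/-- `16^m = 2^{4m}` reindexing: the bit-indexed sum is the hex lift. -/
theorem sum_bits_eq_hexLift (m : ℕ) :
    (∑ e : Fin (4 * m) → Bool, C ((2 : ℂ) ^ vExp (4 * m) (Nat.ofBits e)) *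
        ∏ j : Fin m, (X (j, hexDigit m e j) : MvPolynomial (Fin m × Fin 16) ℂ)) =
      ∑ i ∈ Finset.range (16 ^ m), C ((2 : ℂ) ^ vExp (4 * m) i) *
        ∏ j : Fin m, X (j, (⟨i / 16 ^ (j : ℕ) % 16, Nat.mod_lt _ (by norm_num)⟩ : Fin 16)) := by
  have h16 : (16 : ℕ) ^ m = 2 ^ (4 * m) := by rw [pow_mul]; norm_num
  rw [h16, ← BoolGadgets.sum_boolVec_eq_sum_range (fun i => C ((2 : ℂ) ^ vExp (4 * m) i) *
    ∏ j : Fin m, (X (j, (⟨i / 16 ^ (j : ℕ) % 16, Nat.mod_lt _ (by norm_num)⟩ : Fin 16)) :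
      MvPolynomial (Fin m × Fin 16) ℂ))]
  refine Finset.sum_congr rfl fun e _ => ?_
  congr 1
  refine Finset.prod_congr rfl fun j _ => ?_
  congr 2
  exact Fin.ext (ofBits_div_pow_mod m e j).symm

/-- **THE IDENTITY (PROVED): the Boolean sum of the transcript witness is the hex digit lift of `V_{4m}`.** -/
theorem bsum_witness (m : ℕ) :
    bsum (witness m) = ∑ i ∈ Finset.range (16 ^ m), C ((2 : ℂ) ^ vExp (4 * m) i) *
      ∏ j : Fin m, X (j, (⟨i / 16 ^ (j : ℕ) % 16, Nat.mod_lt _ (by norm_num)⟩ : Fin 16)) := by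
  rw [bsum_witness_bits, sum_bits_eq_hexLift]

/-- The same in Valiant's `boolSum` form (Boolean block enumerated by `Fin`), ready for Def. 2.5. -/
theorem boolSum_witness (m : ℕ) :
    boolSum (rename (Sum.map id (Fintype.equivFin (B m))) (witness m)) =
      ∑ i ∈ Finset.range (16 ^ m), C ((2 : ℂ) ^ vExp (4 * m) i) *
        ∏ j : Fin m, X (j, (⟨i / 16 ^ (j : ℕ) % 16, Nat.mod_lt _ (by norm_num)⟩ : Fin 16)) := by
  classical
  rw [DefVNP.boolSum_rename_equiv, bsum_witness]

/-! ### Cost bounds: Boolean length, complexity, degree -/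

theorem complexity_validPoly_le' {ι : Type*} (Q : Circuit ι) :
    complexity (validPoly (k := ℂ) Q) ≤ 60 * Q.size := by
  unfold validPoly
  refine (complexity_finset_prod_le _ _).trans ?_
  calc ∑ j : Fin Q.size, complexity (consPoly (k := ℂ) Q j) + (Finset.univ : Finset (Fin Q.size)).card
      ≤ ∑ _j : Fin Q.size, 59 + (Finset.univ : Finset (Fin Q.size)).card :=
        Nat.add_le_add_right (Finset.sum_le_sum fun j _ => complexity_consPoly_le Q j) _
    _ = 60 * Q.size := by
        rw [Finset.sum_const, Finset.card_univ, Fintype.card_fin, smul_eq_mul]; ring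

theorem totalDegree_validPoly_le' {ι : Type*} (Q : Circuit ι) :
    (validPoly (k := ℂ) Q).totalDegree ≤ 3 * Q.size := by
  unfold validPoly
  refine (totalDegree_finsetProd _ _).trans ?_
  calc ∑ j : Fin Q.size, (consPoly (k := ℂ) Q j).totalDegree ≤ ∑ _j : Fin Q.size, 3 :=
        Finset.sum_le_sum fun j _ => totalDegree_consPoly_le Q j
    _ = 3 * Q.size := by rw [Finset.sum_const, Finset.card_univ, Fintype.card_fin, smul_eq_mul]; ring

theorem complexity_hselFactor_le (m : ℕ) (j : Fin m) : complexity (hselFactor m j) ≤ 224 := by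
  unfold hselFactor
  refine (complexity_finset_sum_le _ _).trans ?_
  have hterm : ∀ h : Fin 16, complexity ((X (Sum.inl (j, h)) : MvPolynomial (V m ⊕ B m) ℂ) *
      ∏ r : Fin 4, lit (Nat.testBit (h : ℕ) (r : ℕ))
        (X (Sum.inr (Sum.inl (⟨4 * (j : ℕ) + (r : ℕ), by omega⟩ : Fin (4 * m)))))) ≤ 13 := by
    intro h
    refine (complexity_mul_le_holds _ _).trans ?_
    rw [complexity_X_holds]
    have hl : ∀ r : Fin 4, complexity (lit (Nat.testBit (h : ℕ) (r : ℕ))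
        (X (Sum.inr (Sum.inl (⟨4 * (j : ℕ) + (r : ℕ), by omega⟩ : Fin (4 * m)))) :
          MvPolynomial (V m ⊕ B m) ℂ)) ≤ 2 := fun r =>
      (complexity_lit_le _ _).trans (by rw [complexity_X_holds])
    have hp := complexity_finset_prod_le (Finset.univ : Finset (Fin 4))
      (fun r => (lit (Nat.testBit (h : ℕ) (r : ℕ))
        (X (Sum.inr (Sum.inl (⟨4 * (j : ℕ) + (r : ℕ), by omega⟩ : Fin (4 * m)))) :
          MvPolynomial (V m ⊕ B m) ℂ)))
    have hs : ∑ r : Fin 4, complexity (lit (Nat.testBit (h : ℕ) (r : ℕ))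
        (X (Sum.inr (Sum.inl (⟨4 * (j : ℕ) + (r : ℕ), by omega⟩ : Fin (4 * m)))) :
          MvPolynomial (V m ⊕ B m) ℂ)) ≤ ∑ _r : Fin 4, 2 := Finset.sum_le_sum fun r _ => hl r
    rw [Finset.sum_const, Finset.card_univ, Fintype.card_fin, smul_eq_mul] at hs
    rw [Finset.card_univ, Fintype.card_fin] at hp
    omega
  calc ∑ h : Fin 16, complexity ((X (Sum.inl (j, h)) : MvPolynomial (V m ⊕ B m) ℂ) *
        ∏ r : Fin 4, lit (Nat.testBit (h : ℕ) (r : ℕ))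
          (X (Sum.inr (Sum.inl (⟨4 * (j : ℕ) + (r : ℕ), by omega⟩ : Fin (4 * m)))))) +
        (Finset.univ : Finset (Fin 16)).card
      ≤ ∑ _h : Fin 16, 13 + (Finset.univ : Finset (Fin 16)).card :=
        Nat.add_le_add_right (Finset.sum_le_sum fun h _ => hterm h) _
    _ = 224 := by rw [Finset.sum_const, Finset.card_univ, Fintype.card_fin, smul_eq_mul]

theorem complexity_hsel_le (m : ℕ) : complexity (hsel m) ≤ 225 * m := by
  unfold hsel
  refine (complexity_finset_prod_le _ _).trans ?_
  calc ∑ j : Fin m, complexity (hselFactor m j) + (Finset.univ : Finset (Fin m)).card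
      ≤ ∑ _j : Fin m, 224 + (Finset.univ : Finset (Fin m)).card :=
        Nat.add_le_add_right (Finset.sum_le_sum fun j _ => complexity_hselFactor_le m j) _
    _ = 225 * m := by rw [Finset.sum_const, Finset.card_univ, Fintype.card_fin, smul_eq_mul]; ring

theorem complexity_zFactor_le (m : ℕ) (l : Fin (TavenasVn.R (4 * m))) : complexity (zFactor m l) ≤ 2 := by
  unfold zFactor
  have hC : (C ((2 : ℂ) ^ 2 ^ (l : ℕ)) - 1 : MvPolynomial (V m ⊕ B m) ℂ) = C ((2 : ℂ) ^ 2 ^ (l : ℕ) - 1) := by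
    rw [map_sub, C_1]
  have h1 : complexity ((C ((2 : ℂ) ^ 2 ^ (l : ℕ)) - 1) *
      rename Sum.inr (wirePoly (k := ℂ) (vCirc (4 * m)).size (vOut (4 * m) l)) :
        MvPolynomial (V m ⊕ B m) ℂ) ≤ 1 := by
    refine (complexity_mul_le_holds _ _).trans ?_
    rw [hC, complexity_C_holds]
    have hw := (complexity_rename_le_holds' (Sum.inr : B m → V m ⊕ B m)
      (wirePoly (k := ℂ) (vCirc (4 * m)).size (vOut (4 * m) l)))
    rw [complexity_wirePoly] at hw
    omega
  have h2 := complexity_add_le_holds (1 : MvPolynomial (V m ⊕ B m) ℂ)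
    ((C ((2 : ℂ) ^ 2 ^ (l : ℕ)) - 1) *
      rename Sum.inr (wirePoly (k := ℂ) (vCirc (4 * m)).size (vOut (4 * m) l)))
  have h3 : complexity (1 : MvPolynomial (V m ⊕ B m) ℂ) = 0 := by
    rw [← C_1]; exact complexity_C_holds _
  omega

theorem complexity_zprod_le (m : ℕ) : complexity (zprod m) ≤ 3 * TavenasVn.R (4 * m) := by
  unfold zprod
  refine (complexity_finset_prod_le _ _).trans ?_
  calc ∑ l : Fin (TavenasVn.R (4 * m)), complexity (zFactor m l) +
        (Finset.univ : Finset (Fin (TavenasVn.R (4 * m)))).card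
      ≤ ∑ _l : Fin (TavenasVn.R (4 * m)), 2 + (Finset.univ : Finset (Fin (TavenasVn.R (4 * m)))).card :=
        Nat.add_le_add_right (Finset.sum_le_sum fun l _ => complexity_zFactor_le m l) _
    _ = 3 * TavenasVn.R (4 * m) := by
        rw [Finset.sum_const, Finset.card_univ, Fintype.card_fin, smul_eq_mul]; ring

/-- **Complexity of the witness**: `≤ 60·|vCirc (4m)| + 225 m + 3(8m+3) + 2`. -/
theorem complexity_witness_le (m : ℕ) :
    complexity (witness m) ≤ 60 * (vCirc (4 * m)).size + 225 * m + 3 * TavenasVn.R (4 * m) + 2 := by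
  unfold witness
  have hv : complexity (rename Sum.inr (validPoly (k := ℂ) (vCirc (4 * m))) : MvPolynomial (V m ⊕ B m) ℂ) ≤
      60 * (vCirc (4 * m)).size :=
    (complexity_rename_le_holds' _ _).trans (complexity_validPoly_le' _)
  have h1 := complexity_mul_le_holds (rename Sum.inr (validPoly (k := ℂ) (vCirc (4 * m))) : MvPolynomial (V m ⊕ B m) ℂ)
    (hsel m)
  have h2 := complexity_mul_le_holds ((rename Sum.inr (validPoly (k := ℂ) (vCirc (4 * m))) : MvPolynomial (V m ⊕ B m) ℂ) *
    hsel m) (zprod m)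
  have h3 := complexity_hsel_le m
  have h4 := complexity_zprod_le m
  omega

theorem totalDegree_hselFactor_le (m : ℕ) (j : Fin m) : (hselFactor m j).totalDegree ≤ 5 := by
  unfold hselFactor
  refine totalDegree_finsetSum_le fun h _ => ?_
  refine (totalDegree_mul _ _).trans ?_
  have hX := totalDegree_X_le_one' (k := ℂ) (Sum.inl (j, h) : V m ⊕ B m)
  have hp := totalDegree_finsetProd (Finset.univ : Finset (Fin 4))
    (fun r => (lit (Nat.testBit (h : ℕ) (r : ℕ))
      (X (Sum.inr (Sum.inl (⟨4 * (j : ℕ) + (r : ℕ), by omega⟩ : Fin (4 * m)))) :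
        MvPolynomial (V m ⊕ B m) ℂ)))
  have hs : ∑ r : Fin 4, (lit (Nat.testBit (h : ℕ) (r : ℕ))
      (X (Sum.inr (Sum.inl (⟨4 * (j : ℕ) + (r : ℕ), by omega⟩ : Fin (4 * m)))) :
        MvPolynomial (V m ⊕ B m) ℂ)).totalDegree ≤ ∑ _r : Fin 4, 1 :=
    Finset.sum_le_sum fun r _ => (totalDegree_lit_le _ _).trans (totalDegree_X_le_one' (k := ℂ) _)
  rw [Finset.sum_const, Finset.card_univ, Fintype.card_fin, smul_eq_mul] at hs
  omega

theorem totalDegree_hsel_le (m : ℕ) : (hsel m).totalDegree ≤ 5 * m := by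
  unfold hsel
  refine (totalDegree_finsetProd _ _).trans ?_
  calc ∑ j : Fin m, (hselFactor m j).totalDegree ≤ ∑ _j : Fin m, 5 :=
        Finset.sum_le_sum fun j _ => totalDegree_hselFactor_le m j
    _ = 5 * m := by rw [Finset.sum_const, Finset.card_univ, Fintype.card_fin, smul_eq_mul]; ring

theorem totalDegree_zFactor_le (m : ℕ) (l : Fin (TavenasVn.R (4 * m))) : (zFactor m l).totalDegree ≤ 1 := by
  unfold zFactor
  have hC : (C ((2 : ℂ) ^ 2 ^ (l : ℕ)) - 1 : MvPolynomial (V m ⊕ B m) ℂ) = C ((2 : ℂ) ^ 2 ^ (l : ℕ) - 1) := by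
    rw [map_sub, C_1]
  rw [hC]
  refine (totalDegree_add _ _).trans (max_le (by rw [totalDegree_one]; exact Nat.zero_le _) ?_)
  refine (totalDegree_mul _ _).trans ?_
  rw [totalDegree_C, zero_add]
  exact (totalDegree_rename_le _ _).trans (totalDegree_wirePoly_le _)

theorem totalDegree_zprod_le (m : ℕ) : (zprod m).totalDegree ≤ TavenasVn.R (4 * m) := by
  unfold zprod
  refine (totalDegree_finsetProd _ _).trans ?_
  calc ∑ l : Fin (TavenasVn.R (4 * m)), (zFactor m l).totalDegree ≤ ∑ _l : Fin (TavenasVn.R (4 * m)), 1 :=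
        Finset.sum_le_sum fun l _ => totalDegree_zFactor_le m l
    _ = TavenasVn.R (4 * m) := by rw [Finset.sum_const, Finset.card_univ, Fintype.card_fin, smul_eq_mul, mul_one]

/-- **Degree of the witness**: `≤ 3·|vCirc (4m)| + 5m + (8m+3)`. -/
theorem totalDegree_witness_le (m : ℕ) :
    (witness m).totalDegree ≤ 3 * (vCirc (4 * m)).size + 5 * m + TavenasVn.R (4 * m) := by
  unfold witness
  refine (totalDegree_mul _ _).trans ?_
  refine Nat.add_le_add ((totalDegree_mul _ _).trans (Nat.add_le_add ?_ (totalDegree_hsel_le m)))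
    (totalDegree_zprod_le m)
  exact (totalDegree_rename_le _ _).trans (totalDegree_validPoly_le' _)

/-! ### The hex digit lift family and its `VNP` membership (Bürgisser Def. 2.5) -/

/-- The hex digit lift of `V_{4m}` (verbatim the polynomial of stubs V2/T2 of line `hex-bilinear-transport`). -/
def hexLift (m : ℕ) : MvPolynomial (V m) ℂ :=
  ∑ i ∈ Finset.range (16 ^ m), C ((2 : ℂ) ^ vExp (4 * m) i) *
    ∏ j : Fin m, X (j, (⟨i / 16 ^ (j : ℕ) % 16, Nat.mod_lt _ (by norm_num)⟩ : Fin 16))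

theorem totalDegree_hexLift_le (m : ℕ) : (hexLift m).totalDegree ≤ m := by
  unfold hexLift
  refine totalDegree_finsetSum_le fun i _ => ?_
  refine (totalDegree_mul _ _).trans ?_
  rw [totalDegree_C, zero_add]
  refine (totalDegree_finsetProd _ _).trans ?_
  calc ∑ j : Fin m, (X (j, (⟨i / 16 ^ (j : ℕ) % 16, Nat.mod_lt _ (by norm_num)⟩ : Fin 16)) :
          MvPolynomial (V m) ℂ).totalDegree ≤ ∑ _j : Fin m, 1 :=
        Finset.sum_le_sum fun j _ => totalDegree_X_le_one' (k := ℂ) _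
    _ = m := by simp

theorem isPFamily_hexLift : @IsPFamily ℂ _ (fun m => V m) _ hexLift := by
  refine ⟨?_, IsPBounded.mono IsPBounded.id fun m => totalDegree_hexLift_le m⟩
  refine IsPBounded.mono (IsPBounded.mul_holds (IsPBounded.const 16) IsPBounded.id) fun m => ?_
  simp [V, mul_comm]

/-- Tavenas' circuit is polynomial-size in the level. -/
theorem isPBounded_vExpSize : IsPBounded fun m : ℕ => TavenasVn.vExpSize (4 * m) := by
  have c := fun k : ℕ => IsPBounded.const k
  have h4 : IsPBounded (fun m : ℕ => 4 * m) := IsPBounded.mul_holds (c 4) IsPBounded.id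
  have hstep : IsPBounded (fun m : ℕ => Literature.Computability.Complexity.ArithCkt.mulStepSize (4 * m)) := by
    unfold Literature.Computability.Complexity.ArithCkt.mulStepSize
      Literature.Computability.Complexity.ArithCkt.addSize
    exact IsPBounded.add_holds (IsPBounded.add_holds h4 h4)
      (IsPBounded.add_holds (IsPBounded.mul_holds (c 73) (IsPBounded.add_holds h4 h4)) (c 1))
  unfold TavenasVn.vExpSize
  exact IsPBounded.add_holds (IsPBounded.add_holds h4
    (IsPBounded.add_holds (IsPBounded.mul_holds h4 hstep) (c 1))) (c 1)

/-- The cost function of the level-wise assembly. -/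
def bound (m : ℕ) : ℕ := 60 * TavenasVn.vExpSize (4 * m) + 300 * (m + 1)

theorem isPBounded_bound : IsPBounded bound := by
  unfold bound
  exact IsPBounded.add_holds (IsPBounded.mul_holds (IsPBounded.const 60) isPBounded_vExpSize)
    (IsPBounded.mul_holds (IsPBounded.const 300) (IsPBounded.add_holds IsPBounded.id (IsPBounded.const 1)))

theorem card_B (m : ℕ) : Fintype.card (B m) = 4 * m + (vCirc (4 * m)).size := by
  simp [B, TavenasVn.BB]

theorem R_eq (m : ℕ) : TavenasVn.R (4 * m) = 8 * m + 3 := by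
  unfold TavenasVn.R; ring

/-- **V′ (PROVED): the hex digit lift of `V_{4m}` is a `VNP` family over `ℂ`** — Bürgisser Def. 2.5 with the
transcript witness: Boolean length `4m + |vCirc (4m)|`, complexity `≤ 60|vCirc| + 249 m + 11`, degree
`≤ 3|vCirc| + 13 m + 3`, all `≤ bound m = 60·vExpSize (4m) + 300 (m+1)`, p-bounded. -/
theorem isVNPFamily_hexLift : @IsVNPFamily ℂ _ (fun m => V m) _ hexLift := by
  refine isVNPFamily_of_levelwise' isPFamily_hexLift isPBounded_bound fun m => ?_
  have hs : (vCirc (4 * m)).size ≤ TavenasVn.vExpSize (4 * m) := size_vCirc_le (4 * m)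
  refine ⟨Fintype.card (B m), rename (Sum.map id (Fintype.equivFin (B m))) (witness m),
    boolSum_witness m, ?_, ?_, ?_⟩
  · rw [card_B]; unfold bound; omega
  · refine ((complexity_rename_le_holds' _ _).trans (complexity_witness_le m)).trans ?_
    rw [R_eq]; unfold bound; omega
  · refine ((totalDegree_rename_le _ _).trans (totalDegree_witness_le m)).trans ?_
    rw [R_eq]; unfold bound; omega

/-- **V′ in the verbatim form of the registered stub** `stub_vnpHexLift`'s CONCLUSION (no V1 hypothesis). -/
theorem vnpHexLift :
    @IsVNPFamily ℂ _ (fun m => Fin m × Fin 16) _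
      (fun m => ∑ i ∈ Finset.range (16 ^ m), C ((2 : ℂ) ^ vExp (4 * m) i) *
        ∏ j : Fin m, X (j, (⟨i / 16 ^ (j : ℕ) % 16, Nat.mod_lt _ (by norm_num)⟩ : Fin 16))) :=
  isVNPFamily_hexLift

/-! ### T2 (`stub_kroneckerHex` of the registered line) from the landed GENERIC digit-lift lemmas -/

/-- **T2 = `stub_kroneckerHex` (PROVED):** the hex lift is set-multilinear over the `m` blocks, has total degree
exactly `m`, and the inverse Kronecker substitution `y_{(j,h)} ↦ X^{h·16^j}` maps it to `V_{4m}` over `ℂ`. -/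
theorem kroneckerHex (m : ℕ) :
    IsSetMultilinear (Prod.fst : Fin m × Fin 16 → Fin m) Finset.univ
      (∑ i ∈ Finset.range (16 ^ m), C ((2 : ℂ) ^ vExp (4 * m) i) *
        ∏ j : Fin m, X (j, (⟨i / 16 ^ (j : ℕ) % 16, Nat.mod_lt _ (by norm_num)⟩ : Fin 16)) :
          MvPolynomial (Fin m × Fin 16) ℂ) ∧
    (∑ i ∈ Finset.range (16 ^ m), C ((2 : ℂ) ^ vExp (4 * m) i) *
        ∏ j : Fin m, X (j, (⟨i / 16 ^ (j : ℕ) % 16, Nat.mod_lt _ (by norm_num)⟩ : Fin 16)) :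
          MvPolynomial (Fin m × Fin 16) ℂ).totalDegree = m ∧
    MvPolynomial.aeval (fun v : Fin m × Fin 16 => (Polynomial.X : Polynomial ℂ) ^ ((v.2 : ℕ) * 16 ^ (v.1 : ℕ)))
        (∑ i ∈ Finset.range (16 ^ m), C ((2 : ℂ) ^ vExp (4 * m) i) *
          ∏ j : Fin m, X (j, (⟨i / 16 ^ (j : ℕ) % 16, Nat.mod_lt _ (by norm_num)⟩ : Fin 16)) :
            MvPolynomial (Fin m × Fin 16) ℂ) =
      (tavenasV (4 * m)).map (Int.castRingHom ℂ) := by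
  have hdig : ∀ i ∈ Finset.range (16 ^ m),
      ∑ j : Fin m, (((⟨i / 16 ^ (j : ℕ) % 16, Nat.mod_lt _ (by norm_num)⟩ : Fin 16) : ℕ)) * 16 ^ (j : ℕ) = i :=
    fun i hi => dk_sum_digit_mul_pow 16 (by norm_num) m i (Finset.mem_range.1 hi)
  refine ⟨dk_isSetMultilinear_lift m 16 _ (fun i => (2 : ℂ) ^ vExp (4 * m) i) _, ?_, ?_⟩
  · refine dk_totalDegree_lift m 16 _ (fun i => (2 : ℂ) ^ vExp (4 * m) i)
      (fun i j => (⟨i / 16 ^ (j : ℕ) % 16, Nat.mod_lt _ (by norm_num)⟩ : Fin 16)) 0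
      (Finset.mem_range.2 (by positivity)) (fun i hi hd0 => ?_) (pow_ne_zero _ two_ne_zero)
    have h := hdig i hi
    have h0 : ∀ j : Fin m, i / 16 ^ (j : ℕ) % 16 = 0 := fun j => by
      have := congrArg (fun f => ((f j : Fin 16) : ℕ)) hd0
      simpa using this
    rw [← h]
    exact Finset.sum_eq_zero fun j _ => by simp [h0 j]
  · rw [dk_aeval_lift m 16 _ (fun i => (2 : ℂ) ^ vExp (4 * m) i) _ hdig, map_tavenasV' ℂ (4 * m)]
    have h16 : (16 : ℕ) ^ m = 2 ^ (4 * m) := by rw [pow_mul]; norm_num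
    rw [h16]

end PartA

/-! # Part B — T3 (budget) and R (realification) -/


/-! ## T3: the linear-threshold budget at radix 16 -/

/-- `m^c + c ≤ (m+1)^{c+1}` for `m ≥ 1`. -/
theorem pow_add_le_succ_pow (m c : ℕ) (hm : 1 ≤ m) : m ^ c + c ≤ (m + 1) ^ (c + 1) := by
  have h1 : m ^ c ≤ (m + 1) ^ c := Nat.pow_le_pow_left (Nat.le_succ m) c
  have h2 : c ≤ m * (m + 1) ^ c := by
    have : c < 2 ^ c := Nat.lt_two_pow_self
    have : 2 ^ c ≤ (m + 1) ^ c := Nat.pow_le_pow_left (by omega) c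
    nlinarith
  calc m ^ c + c ≤ (m + 1) ^ c + m * (m + 1) ^ c := Nat.add_le_add h1 h2
    _ = (m + 1) ^ (c + 1) := by ring

/-- The quasi-polynomial factor is at most `2^{(M+1)((2c+10)M+1)}` with `M = log₂ m`. -/
theorem quasiPoly_le (c m L : ℕ) (hm : 1 ≤ m) (hL : L ≤ m ^ c + c) :
    (m + 1) * ((4 * L * (m + 1) ^ 2) * (4 * L * (m + 1) ^ 2)) ^ Nat.log 2 m ≤
      2 ^ ((Nat.log 2 m + 1) * ((2 * c + 10) * Nat.log 2 m + 1)) := by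
  set M := Nat.log 2 m with hM
  have hm2 : m + 1 ≤ 2 ^ (M + 1) := Nat.lt_pow_succ_log_self one_lt_two m
  have hL' : L ≤ (m + 1) ^ (c + 1) := hL.trans (pow_add_le_succ_pow m c hm)
  have h4 : 4 ≤ (m + 1) ^ 2 := by nlinarith
  have hX : 4 * L * (m + 1) ^ 2 ≤ (m + 1) ^ (c + 5) := by
    calc 4 * L * (m + 1) ^ 2 ≤ (m + 1) ^ 2 * (m + 1) ^ (c + 1) * (m + 1) ^ 2 := by
          gcongr
      _ = (m + 1) ^ (c + 5) := by ring
  have hXX : (4 * L * (m + 1) ^ 2) * (4 * L * (m + 1) ^ 2) ≤ (m + 1) ^ (2 * c + 10) := by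
    calc (4 * L * (m + 1) ^ 2) * (4 * L * (m + 1) ^ 2) ≤ (m + 1) ^ (c + 5) * (m + 1) ^ (c + 5) :=
          Nat.mul_le_mul hX hX
      _ = (m + 1) ^ (2 * c + 10) := by ring
  calc (m + 1) * ((4 * L * (m + 1) ^ 2) * (4 * L * (m + 1) ^ 2)) ^ M
      ≤ (m + 1) * ((m + 1) ^ (2 * c + 10)) ^ M := Nat.mul_le_mul_left _ (Nat.pow_le_pow_left hXX M)
    _ = (m + 1) ^ ((2 * c + 10) * M + 1) := by rw [← pow_mul, ← pow_succ']
    _ ≤ (2 ^ (M + 1)) ^ ((2 * c + 10) * M + 1) := Nat.pow_le_pow_left hm2 _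
    _ = 2 ^ ((M + 1) * ((2 * c + 10) * M + 1)) := by rw [← pow_mul]

/-- The two half-lift sparsities: `16^{⌊m/2⌋} + 16^{⌈m/2⌉} ≤ 2^{2m+3}`. -/
theorem halves_le (m : ℕ) : 16 ^ (m / 2) + 16 ^ (m - m / 2) ≤ 2 ^ (2 * m + 3) := by
  have h1 : 16 ^ (m / 2) ≤ 16 ^ (m - m / 2) := Nat.pow_le_pow_right (by norm_num) (by omega)
  have h2 : 16 ^ (m - m / 2) = 2 ^ (4 * (m - m / 2)) := by
    rw [pow_mul]; norm_num
  have h3 : 2 ^ (4 * (m - m / 2)) ≤ 2 ^ (2 * m + 2) := Nat.pow_le_pow_right (by norm_num) (by omega)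
  calc 16 ^ (m / 2) + 16 ^ (m - m / 2) ≤ 2 * 16 ^ (m - m / 2) := by omega
    _ ≤ 2 * 2 ^ (2 * m + 2) := by rw [h2]; exact Nat.mul_le_mul_left 2 h3
    _ = 2 ^ (2 * m + 3) := by ring

/-- **T3 = `stub_hexBudget` (PROVED):** quasi-polynomial · `8^m` is eventually below `η · 16^m`. -/
theorem hexBudget :
    ∀ (c : ℕ) (η : ℝ), 0 < η → ∃ m₀ : ℕ, ∀ m : ℕ, m₀ ≤ m → ∀ L : ℕ, L ≤ m ^ c + c →
      ((2 ^ (m + 1) * ((m + 1) * ((4 * L * (m + 1) ^ 2) * (4 * L * (m + 1) ^ 2)) ^ Nat.log 2 m) *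
          (16 ^ (m / 2) + 16 ^ (m - m / 2)) : ℕ) : ℝ) < η * 2 ^ (4 * m) := by
  intro c η hη
  -- `η > (1/2)^K`
  obtain ⟨K, hK⟩ := exists_pow_lt_of_lt_one hη (by norm_num : (1 / 2 : ℝ) < 1)
  -- the threshold: `M = log₂ m ≥ 10 (A + 1)` with `A = 2c + K + 16`
  set A := 2 * c + K + 16 with hA
  refine ⟨2 ^ (10 * (A + 1)), fun m hm L hL => ?_⟩
  have hm1 : 1 ≤ m := le_trans Nat.one_le_two_pow hm
  set M := Nat.log 2 m with hM
  have hMge : 10 * (A + 1) ≤ M := Nat.le_log_of_pow_le one_lt_two hm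
  have h2M : 2 ^ M ≤ m := Nat.pow_log_le_self 2 (by omega)
  -- the exponent budget `E + K + 5 ≤ m`
  set E := (M + 1) * ((2 * c + 10) * M + 1) with hE
  have hEm : E + K + 5 ≤ m := by
    have hsq := mul_sq_le_two_pow A M hMge
    have : E + K + 5 ≤ A * (M + 1) ^ 2 := by
      rw [hE, hA]
      nlinarith [Nat.zero_le M, Nat.zero_le c, Nat.zero_le K]
    omega
  -- the ℕ bound `N · 2^{K+1} ≤ 2^{4m}`
  have hT := quasiPoly_le c m L hm1 hL
  have hH := halves_le m
  set N := 2 ^ (m + 1) * ((m + 1) * ((4 * L * (m + 1) ^ 2) * (4 * L * (m + 1) ^ 2)) ^ Nat.log 2 m) *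
    (16 ^ (m / 2) + 16 ^ (m - m / 2)) with hN
  have hNle : N ≤ 2 ^ (3 * m + 4 + E) := by
    calc N ≤ 2 ^ (m + 1) * 2 ^ E * 2 ^ (2 * m + 3) := by
          rw [hN]; exact Nat.mul_le_mul (Nat.mul_le_mul_left _ hT) hH
      _ = 2 ^ (3 * m + 4 + E) := by rw [← pow_add, ← pow_add]; congr 1; ring
  have hNK : N * 2 ^ (K + 1) ≤ 2 ^ (4 * m) := by
    calc N * 2 ^ (K + 1) ≤ 2 ^ (3 * m + 4 + E) * 2 ^ (K + 1) := Nat.mul_le_mul_right _ hNle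
      _ = 2 ^ (3 * m + 4 + E + (K + 1)) := by rw [← pow_add]
      _ ≤ 2 ^ (4 * m) := Nat.pow_le_pow_right (by norm_num) (by omega)
  -- to ℝ
  have hR : (N : ℝ) * 2 ^ (K + 1) ≤ 2 ^ (4 * m) := by exact_mod_cast hNK
  have h2K : (0 : ℝ) < 2 ^ (K + 1) := by positivity
  have hηK : 1 < η * 2 ^ (K + 1) := by
    have h1 : (1 / 2 : ℝ) ^ K * 2 ^ (K + 1) = 2 := by
      rw [pow_succ, one_div, inv_pow, ← mul_assoc, inv_mul_cancel₀ (by positivity)]; ring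
    nlinarith [mul_lt_mul_of_pos_right hK h2K]
  have h4m : (0 : ℝ) < 2 ^ (4 * m) := by positivity
  -- `N ≤ 2^{4m}/2^{K+1} < η 2^{4m}`
  by_contra hcon
  push Not at hcon
  have := mul_le_mul_of_nonneg_right hcon h2K.le
  nlinarith

/-! ## R: Dutta 2021 Lemma 10 — a complex weighted SOS representation of a real polynomial yields a real one, support ×3 ≤ ×4 -/

section Realify

open Polynomial

/-- Coefficientwise real part of a complex polynomial. -/
def reP (p : ℂ[X]) : ℝ[X] := ∑ k ∈ p.support, C (p.coeff k).re * X ^ k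

/-- Coefficientwise imaginary part of a complex polynomial. -/
def imP (p : ℂ[X]) : ℝ[X] := ∑ k ∈ p.support, C (p.coeff k).im * X ^ k

theorem coeff_reP (p : ℂ[X]) (k : ℕ) : (reP p).coeff k = (p.coeff k).re := by
  unfold reP
  rw [finsetSum_coeff]
  simp only [coeff_C_mul_X_pow]
  rw [Finset.sum_ite_eq]
  by_cases hk : k ∈ p.support
  · rw [if_pos hk]
  · rw [if_neg hk, notMem_support_iff.1 hk, Complex.zero_re]

theorem coeff_imP (p : ℂ[X]) (k : ℕ) : (imP p).coeff k = (p.coeff k).im := by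
  unfold imP
  rw [finsetSum_coeff]
  simp only [coeff_C_mul_X_pow]
  rw [Finset.sum_ite_eq]
  by_cases hk : k ∈ p.support
  · rw [if_pos hk]
  · rw [if_neg hk, notMem_support_iff.1 hk, Complex.zero_im]

theorem support_reP_subset (p : ℂ[X]) : (reP p).support ⊆ p.support := by
  intro k hk
  rw [mem_support_iff] at hk ⊢
  rw [coeff_reP] at hk
  intro h; exact hk (by rw [h, Complex.zero_re])

theorem support_imP_subset (p : ℂ[X]) : (imP p).support ⊆ p.support := by
  intro k hk
  rw [mem_support_iff] at hk ⊢
  rw [coeff_imP] at hk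
  intro h; exact hk (by rw [h, Complex.zero_im])

/-- `p = (Re p)_ℂ + i·(Im p)_ℂ`. -/
theorem reP_add_imP (p : ℂ[X]) :
    (reP p).map (algebraMap ℝ ℂ) + C Complex.I * (imP p).map (algebraMap ℝ ℂ) = p := by
  ext k
  rw [coeff_add, coeff_C_mul, coeff_map, coeff_map, coeff_reP, coeff_imP]
  simp only [Complex.coe_algebraMap]
  rw [mul_comm]
  exact Complex.re_add_im _

/-- The real part of `R_ℂ + i·S_ℂ` is `R`. -/
theorem reP_map_add (R S : ℝ[X]) :
    reP (R.map (algebraMap ℝ ℂ) + C Complex.I * S.map (algebraMap ℝ ℂ)) = R := by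
  ext k
  rw [coeff_reP, coeff_add, coeff_C_mul, coeff_map, coeff_map]
  simp

/-- `reP` is additive. -/
theorem reP_add (p q : ℂ[X]) : reP (p + q) = reP p + reP q := by
  ext k; simp [coeff_reP]

theorem reP_zero : reP 0 = 0 := by
  ext k; simp [coeff_reP]

theorem reP_sum {ι : Type*} (s : Finset ι) (p : ι → ℂ[X]) : reP (∑ i ∈ s, p i) = ∑ i ∈ s, reP (p i) := by
  classical
  induction s using Finset.induction_on with
  | empty => simp [reP_zero]
  | insert a s ha ih => rw [Finset.sum_insert ha, Finset.sum_insert ha, reP_add, ih]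

/-- **Dutta's identity:** `Re(a·g²) = Re a·(u² − v²) − Im a·(2uv)` for `g = u_ℂ + i v_ℂ`. -/
theorem reP_C_mul_sq (a : ℂ) (g : ℂ[X]) :
    reP (C a * g ^ 2) = C a.re * (reP g ^ 2 - imP g ^ 2) - C a.im * (2 * reP g * imP g) := by
  set u := reP g
  set v := imP g
  have hg : g = u.map (algebraMap ℝ ℂ) + C Complex.I * v.map (algebraMap ℝ ℂ) := (reP_add_imP g).symm
  set U := u.map (algebraMap ℝ ℂ) with hU
  set V := v.map (algebraMap ℝ ℂ) with hV
  set J : ℂ[X] := C Complex.I with hJ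
  have hJJ : J * J = -1 := by
    rw [hJ, ← map_mul, Complex.I_mul_I, map_neg, map_one]
  have ha : C a = C (a.re : ℂ) + C (a.im : ℂ) * J := by
    conv_lhs => rw [← Complex.re_add_im a]
    rw [map_add, map_mul]
  have key : C a * g ^ 2 =
      (C a.re * (u ^ 2 - v ^ 2) - C a.im * (2 * u * v)).map (algebraMap ℝ ℂ) +
        J * (C a.im * (u ^ 2 - v ^ 2) + C a.re * (2 * u * v)).map (algebraMap ℝ ℂ) := by
    rw [hg, ha]
    simp only [Polynomial.map_add, Polynomial.map_sub, Polynomial.map_mul, Polynomial.map_pow,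
      Polynomial.map_C, Polynomial.map_ofNat, Complex.coe_algebraMap]
    rw [← hU, ← hV]
    linear_combination (C (a.re : ℂ) * V ^ 2 + 2 * C (a.im : ℂ) * U * V + C (a.im : ℂ) * J * V ^ 2) * hJJ
  rw [key, hJ, reP_map_add]

variable {s : ℕ}

/-- **R = `stub_complexToReal` = support item `SOSTau.ComplexToRealSOS` (PROVED):** Dutta 2021 Lemma 10 with
three real squares per complex square: `Re(a g²) = (α+β)u² + (β−α)v² − β(u+v)²`, all supported inside `supp g`. -/
theorem complexToRealSOS : Summit.ValiantsHypothesis.ValiantsHypothesis.Theses.SOSTau.ComplexToRealSOS := by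
  intro f s a g hrep
  classical
  -- real data
  set α : Fin s → ℝ := fun i => (a i).re
  set β : Fin s → ℝ := fun i => (a i).im
  set u : Fin s → ℝ[X] := fun i => reP (g i)
  set v : Fin s → ℝ[X] := fun i => imP (g i)
  -- the real identity
  have hreal : f = ∑ i, (C (α i) * (u i ^ 2 - v i ^ 2) - C (β i) * (2 * u i * v i)) := by
    have h := congrArg reP hrep
    rw [reP_sum] at h
    simp only [reP_C_mul_sq] at h
    have hf : reP (f.map (algebraMap ℝ ℂ)) = f := by
      have := reP_map_add f 0
      simpa using this
    rw [hf] at h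
    exact h.symm
  -- three squares per index
  let A : Fin s × Fin 3 → ℝ := fun x => ![α x.1 + β x.1, β x.1 - α x.1, -β x.1] x.2
  let G : Fin s × Fin 3 → ℝ[X] := fun x => ![u x.1, v x.1, u x.1 + v x.1] x.2
  let e : Fin s × Fin 3 ≃ Fin (s * 3) := finProdFinEquiv
  refine ⟨s * 3, fun y => A (e.symm y), fun y => G (e.symm y), ?_, ?_⟩
  · -- the representation
    rw [hreal]
    rw [← Equiv.sum_comp e.symm.symm (fun y => C (A (e.symm y)) * G (e.symm y) ^ 2)]
    simp only [Equiv.symm_symm, Equiv.symm_apply_apply]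
    rw [Fintype.sum_prod_type]
    refine Finset.sum_congr rfl fun i _ => ?_
    simp only [A, G, Fin.sum_univ_three, Matrix.cons_val_zero, Matrix.cons_val_one, Matrix.cons_val_two,
      Matrix.head_cons, Matrix.tail_cons, map_add, map_sub, map_neg]
    ring
  · -- the support count: `Σ ≤ 3 Σ|supp g_i| ≤ 4 Σ|supp g_i|`
    rw [← Equiv.sum_comp e.symm.symm (fun y => (G (e.symm y)).support.card)]
    simp only [Equiv.symm_symm, Equiv.symm_apply_apply]
    rw [Fintype.sum_prod_type, Finset.mul_sum]
    refine Finset.sum_le_sum fun i _ => ?_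
    have hu : (u i).support.card ≤ (g i).support.card := Finset.card_le_card (support_reP_subset _)
    have hv : (v i).support.card ≤ (g i).support.card := Finset.card_le_card (support_imP_subset _)
    have huv : (u i + v i).support.card ≤ (g i).support.card :=
      (Finset.card_le_card ((support_add).trans
        (Finset.union_subset (support_reP_subset _) (support_imP_subset _))))
    simp only [G, Fin.sum_univ_three, Matrix.cons_val_zero, Matrix.cons_val_one, Matrix.cons_val_two,
      Matrix.head_cons, Matrix.tail_cons]
    omega

end Realify


/-! # Part C — the registered composition with all stubs discharged -/

section PartC

open MvPolynomial

/-- **Support item stmt-ValiantsHypothesis-18751 `CollapseCheapComplexSOS` (PROVED)** — the registered composition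
`collapse_of` of `Lines/hex_bilinear_transport.lean` (planner-cstrat-…-b1-0) with its four stubs V1, V2, T2, T3 DISCHARGED by
`vnpHexLift`, `kroneckerHex`, `hexBudget` above. -/
theorem collapseCheapComplexSOS :
    Summit.ValiantsHypothesis.ValiantsHypothesis.Theses.SOSTau.CollapseCheapComplexSOS := by
  classical
  intro hEq η hη n₀
  -- (1) the hex lift family is in VNP (V2 ∘ V1), hence in VP under the collapse: a complexity exponent `c`
  have h1 := vnpHexLift
  have hVP : @IsVPFamily ℂ _ (fun m => Fin m × Fin 16) _
      (fun m => ∑ i ∈ Finset.range (16 ^ m), C ((2 : ℂ) ^ vExp (4 * m) i) *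
        ∏ j : Fin m, X (j, (⟨i / 16 ^ (j : ℕ) % 16, Nat.mod_lt _ (by norm_num)⟩ : Fin 16))) := by
    have hmem := (mem_VNP_ofFintype_iff_holds (k := ℂ) (σ := fun m => Fin m × Fin 16) _).2 h1
    rw [← hEq] at hmem
    exact (mem_VP_ofFintype_iff_holds (k := ℂ) (σ := fun m => Fin m × Fin 16) _).1 hmem
  obtain ⟨c, hc⟩ := hVP.2
  -- (2) the budget threshold and a large level `m`
  obtain ⟨m₀, hm₀⟩ := hexBudget c η hη
  obtain ⟨m, hm₀m, hn₀m, h2m⟩ : ∃ m, m₀ ≤ m ∧ n₀ ≤ m ∧ 2 ≤ m :=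
    ⟨max (max m₀ n₀) 2, le_trans (le_max_left _ _) (le_max_left _ _),
      le_trans (le_max_right _ _) (le_max_left _ _), le_max_right _ _⟩
  refine ⟨4 * m, by omega, ?_⟩
  -- the level-`m` lift `P` and the inverse Kronecker substitution `κ`
  set P : MvPolynomial (Fin m × Fin 16) ℂ :=
    ∑ i ∈ Finset.range (16 ^ m), C ((2 : ℂ) ^ vExp (4 * m) i) *
      ∏ j : Fin m, X (j, (⟨i / 16 ^ (j : ℕ) % 16, Nat.mod_lt _ (by norm_num)⟩ : Fin 16)) with hPdef
  set κ : Fin m × Fin 16 → Polynomial ℂ :=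
    fun v => (Polynomial.X : Polynomial ℂ) ^ ((v.2 : ℕ) * 16 ^ (v.1 : ℕ)) with hκdef
  have hcm : complexity P ≤ m ^ c + c := hc m
  have hB := hm₀ m hm₀m (complexity P) hcm
  -- (3) lift facts (T2): set-multilinear, total degree `m`, `κ P = V_{4m}`
  obtain ⟨hsml, hdeg, hfaith⟩ := kroneckerHex m
  -- (4) the bilinear middle cut at `j = m / 2` (tree: DST24 Lemma 3.1, steps 1–4)
  have h2deg : 2 ≤ P.totalDegree := by rw [hdeg]; exact h2m
  obtain ⟨-, Lst, hLlen, hLdeg, hLsum⟩ := exists_bilin_of_two_le_totalDegree P h2deg (m / 2)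
  rw [hdeg] at hLlen hLdeg
  set t := Lst.length with ht
  have hPsum : P = ∑ i : Fin t, (Lst[(i : ℕ)]).1 * (Lst[(i : ℕ)]).2 := by
    rw [Fin.sum_univ_fun_getElem Lst fun gh => gh.1 * gh.2]
    exact hLsum.symm
  have hgdeg : ∀ i : Fin t, (Lst[(i : ℕ)]).1.totalDegree ≤ m / 2 := fun i =>
    (hLdeg _ (List.getElem_mem i.2)).1
  have hhdeg : ∀ i : Fin t, (Lst[(i : ℕ)]).2.totalDegree ≤ m - m / 2 := fun i =>
    (hLdeg _ (List.getElem_mem i.2)).2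
  -- (5) set-multilinear projection + polarisation (tree: `stub_polarisedSOS`, radix 16)
  obtain ⟨s, a, q, hs, hrep, hsupp, hbsm⟩ :=
    stub_polarisedSOS m 16 t (m / 2) (m - m / 2) P
      (fun i => (Lst[(i : ℕ)]).1) (fun i => (Lst[(i : ℕ)]).2) (by norm_num) hsml hPsum hgdeg hhdeg
  -- (6) Kronecker transport of the identity and of the supports (tree: `dk_partA`)
  have hGrep : (∑ i, Polynomial.C (a i) * (MvPolynomial.aeval κ (q i)) ^ 2) =
      (tavenasV (4 * m)).map (Int.castRingHom ℂ) := by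
    have h := congrArg (MvPolynomial.aeval κ) hrep
    rw [hfaith, map_sum] at h
    simp only [map_mul, map_pow, MvPolynomial.aeval_C, Polynomial.algebraMap_eq] at h
    exact h.symm
  have hGsupp : ∀ i, (MvPolynomial.aeval κ (q i)).support.card ≤ 16 ^ (m / 2) + 16 ^ (m - m / 2) :=
    fun i => ((dk_partA m 16 (q i) (hbsm i)).1).trans (hsupp i)
  refine ⟨s, a, fun i => MvPolynomial.aeval κ (q i), hGrep, ?_⟩
  -- (7) the support-sum count against the budget
  have hsT : s ≤ 2 ^ (m + 1) * ((m + 1) * ((4 * complexity P * (m + 1) ^ 2) *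
      (4 * complexity P * (m + 1) ^ 2)) ^ Nat.log 2 m) :=
    hs.trans (Nat.mul_le_mul_left _ hLlen)
  have hsum : (∑ i, ((MvPolynomial.aeval κ (q i)).support.card : ℝ)) ≤
      ((2 ^ (m + 1) * ((m + 1) * ((4 * complexity P * (m + 1) ^ 2) *
        (4 * complexity P * (m + 1) ^ 2)) ^ Nat.log 2 m) *
        (16 ^ (m / 2) + 16 ^ (m - m / 2)) : ℕ) : ℝ) := by
    calc (∑ i, ((MvPolynomial.aeval κ (q i)).support.card : ℝ))
        ≤ ∑ _i : Fin s, ((16 ^ (m / 2) + 16 ^ (m - m / 2) : ℕ) : ℝ) :=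
          Finset.sum_le_sum fun i _ => by exact_mod_cast hGsupp i
      _ = (s : ℝ) * ((16 ^ (m / 2) + 16 ^ (m - m / 2) : ℕ) : ℝ) := by
          rw [Finset.sum_const, Finset.card_univ, Fintype.card_fin, nsmul_eq_mul]
      _ ≤ _ := by exact_mod_cast Nat.mul_le_mul_right _ hsT
  exact lt_of_le_of_lt hsum hB

/-! ## Composition, part 2 (PROVED): the five stubs imply the crux BY NAME -/

/-- **THE CRUX `SOSTau.HutchinsonMagnification` (stmt-ValiantsHypothesis-18749), PROVED** — the registered composition
`HutchinsonMagnification_of` with its stubs discharged (`vnpHexLift`, `kroneckerHex`, `hexBudget`, `complexToRealSOS`; V1 not needed): linear real sparse-SOS hardness of Tavenas' `V_n` implies `VP_ℂ ≠ VNP_ℂ`. -/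
theorem hutchinsonMagnification :
    Summit.ValiantsHypothesis.ValiantsHypothesis.Theses.SOSTau.HutchinsonMagnification := by
  classical
  have hCol := collapseCheapComplexSOS
  have hCR := complexToRealSOS
  rintro ⟨η, hη, n₀, H⟩
  show Literature.Computability.AlgebraicComplexity.VP ℂ ≠
    Literature.Computability.AlgebraicComplexity.VNP ℂ
  intro hEq
  obtain ⟨n, hn, s, a, g, hrep, hlt⟩ := hCol hEq (η / 4) (by positivity) n₀
  have hrep' : (∑ i, Polynomial.C (a i) * g i ^ 2) =
      ((tavenasV n).map (Int.castRingHom ℝ)).map (algebraMap ℝ ℂ) := by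
    rw [hrep, Polynomial.map_map]
    congr 1
  obtain ⟨s', a', g', hreal, hle⟩ := hCR ((tavenasV n).map (Int.castRingHom ℝ)) s a g hrep'
  have key := H n hn s' a' g' hreal
  have hcast : (∑ i, ((g' i).support.card : ℝ)) ≤ 4 * ∑ i, ((g i).support.card : ℝ) := by
    have := (Nat.cast_le (α := ℝ)).mpr hle
    push_cast at this
    exact this
  have h2 : (0 : ℝ) < 2 ^ n := by positivity
  linarith



end PartC

end Summit.ValiantsHypothesis.ValiantsHypothesis.Cruxes.HutchinsonMagnification.DefinabilityProjection

end
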